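import Literature.NumberTheory.ComplexMultiplication.FaltingsTateOfCMStructure
import Summits.HodgeConjecture.HodgeConjecture.Theorems.HCCMUnconditionalShimuraThm18_6Holds
import HarnessLib

/-!
# T5 (N7b) — [Fal83 §5 Kor. 1] for powers of ANY CM abelian variety over a number field, UNCONDITIONALLY

Cell hodgecm-mathlib, fan A, binder hLiu418 (item stmt-HodgeConjecture-24832), sub-skeleton
`Cruxes/HLiu418/Lines/faltings_isogeny.lean` (row VI-1 = the floor binder
`hFal : ∀ {K} [Field K] (A B : AbelianVariety K) ℓ [Fact ℓ.Prime], faltings_tate_bijective A B ℓ`; T5 ledger row (N7b),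
A-plan1 g8).  The Literature head `Literature.NumberTheory.ComplexMultiplication.faltings_tate_bijective_of_isIsogenous_pow_of_CM_of_thm18_6`
proves, granted the named fact `shimura1998_thm18_6` ([Shimura 1998, Thm. 18.6]), that for a structure `(A₀, ι₀)` of ANY
CM type `(K, Φ)` over a number field `k ⊆ ℂ` (so `2 dim A₀ = [K:ℚ]`), every `A ∼ A₀ᵃ`, every `B ∼ A₀ᵇ` and every prime `ℓ`
the Tate map `ℤ_ℓ ⊗ Hom_k(A, B) → Hom_{Γ_k}(T_ℓ A, T_ℓ B)` is bijective; that fact is a THEOREM of the tree Summits-side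
(`Theorems.shimura1998_thm18_6_holds`, row II-1), so here the VI-1 TEXT ITSELF is decided with NO hypothesis for every
abelian variety with complex multiplication by a CM field of degree `2·dim` over a number field (and the isogeny
classes of its powers) — the end of the T5 CM ladder ★ `HLiu418FaltingsTateOfCMElliptic*` (g = 1) ⊂ ★
`HLiu418FaltingsTateOfPrimitiveCM` (primitive types) ⊂ THIS FILE (all CM types).  Witness rung («distance ledger»); no
floor change, books 0: [Fal83] itself remains the residue for abelian varieties WITHOUT complex multiplication.

HC_CM is proved only modulo the printed citations of the floor until rung 0 closes; this file moves no floor binder.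
-/

-- mandated namespace `Summit.HodgeConjecture.HodgeConjecture.Theorems` trips `linter.dupNamespace` (single-problem
-- summit); off as in `HCCMUnconditionalShimuraThm18_6Holds.lean`.
set_option linter.dupNamespace false

open CategoryTheory CategoryTheory.Limits NumberField
open scoped NumberField

namespace Summit.HodgeConjecture.HodgeConjecture.Theorems

open Literature.AlgebraicGeometry.Motives
open Literature.NumberTheory.ComplexMultiplication

/-- **[Faltings 1983, §5 Kor. 1] on the isogeny class of powers of ANY CM abelian variety over a number field,
unconditionally**: for `(A₀, ι₀)` of CM type `(K, Φ)` over a number field `k ⊆ ℂ`, all `a b`, every `A` `k`-isogenous to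
`⨁_{Fin a} A₀`, every `B` `k`-isogenous to `⨁_{Fin b} A₀` and every prime `ℓ`, `faltings_tate_bijective A B ℓ` — the
Literature head fed with the tree's theorem `shimura1998_thm18_6_holds` ([Shimura 1998, Thm. 18.6], row II-1).
[cite: Faltings1983Endlichkeit, §5 Korollar 1] [cite: Shimura1998, §6.2 Theorem 3, §8.2 Proposition 26, §13.2 Theorem 2 and §18.6 Theorem 18.6] -/
theorem faltings_tate_bijective_of_isIsogenous_pow_of_CM
    {k : Type} [Field k] [Algebra k ℂ] {K : Type} [Field K] [NumberField K] [IsCMField K]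
    (Φ : CMType K) (A₀ : AbelianVariety k) (ι₀ : 𝓞 K →+* End A₀) (hA : IsCMTypeRealisationOver Φ A₀ ι₀)
    {a b : ℕ} {A B : AbelianVariety k} (hAiso : AbelianVariety.IsIsogenous (⨁ fun _ : Fin a => A₀) A)
    (hBiso : AbelianVariety.IsIsogenous (⨁ fun _ : Fin b => A₀) B) (ℓ : ℕ) [Fact ℓ.Prime] :
    faltings_tate_bijective A B ℓ := by
  intro hk
  exact faltings_tate_bijective_of_isIsogenous_pow_of_CM_of_thm18_6 shimura1998_thm18_6_holds Φ A₀ ι₀ hA hAiso hBiso ℓ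

/-- **[Faltings 1983, §5 Kor. 1] for a CM abelian variety and itself (`End` form), unconditionally**: for `(A₀, ι₀)` of
CM type `(K, Φ)` over a number field `k ⊆ ℂ` and every prime `ℓ`, `faltings_tate_bijective A₀ A₀ ℓ`.
[cite: Faltings1983Endlichkeit, §5 Satz 4 and Korollar 1] [cite: Shimura1998, §6.2 Theorem 3 and §18.6 Theorem 18.6] -/
theorem faltings_tate_bijective_self_of_CM
    {k : Type} [Field k] [Algebra k ℂ] {K : Type} [Field K] [NumberField K] [IsCMField K]
    (Φ : CMType K) (A₀ : AbelianVariety k) (ι₀ : 𝓞 K →+* End A₀) (hA : IsCMTypeRealisationOver Φ A₀ ι₀)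
    (ℓ : ℕ) [Fact ℓ.Prime] : faltings_tate_bijective A₀ A₀ ℓ := by
  intro hk
  exact faltings_tate_bijective_self_of_CM_of_thm18_6 shimura1998_thm18_6_holds Φ A₀ ι₀ hA ℓ

end Summit.HodgeConjecture.HodgeConjecture.Theorems
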